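import Summits.QuantumFields.YangMills.Theses.TransportPerturbation
import Summits.QuantumFields.YangMills.Theorems.ColdStartUniversalityLatticeLangevinLawUniqueStart
import Literature.MathematicalPhysics.QuantumFieldTheory.Balaban1983to89.T3UnitScaleTilt
import Literature.MathematicalPhysics.QuantumFieldTheory.Balaban1983to89.T4ApexTwoLevel
import HarnessLib

/-!
# Route `TransportPerturbation`, LINE 16 «synchronous_shadow» (crux K2 `WeightedAlmostInvariance`, stmt-QuantumFields-26987;
# load-bearing item `RegularWindowShadow`, stmt-QuantumFields-27784): the REGISTERED STUB L `stub_lawTransfer` BY NAME AND SIGNATURE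

Planner ym-idea-5 g11 registered the r3 skeleton `SynchronousShadow.lean` (sha eb632437…) on both items with the four stubs
`stub_fineWindowIdentity` (M) / `stub_lawTransfer` (S) / `stub_synchronousCoupling` (XL, load-bearing) /
`stub_couplingToWeighted` (S/M).  Per the planner's STUB-PLAN-L-W-C.md («prove the REGISTERED name + signature in namespace
`Summit.QuantumFields.YangMills.Cruxes.WeightedAlmostInvariance.SynchronousShadow`»), this file reproduces the skeleton's
abbreviations, definitions, stub statements and `__Registered.*` aliases VERBATIM (so that later stub files and the final
assembly import ONE copy), and proves the registered stub

  `theorem stub_lawTransfer : __Registered.stub_lawTransfer`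

— LAW TRANSFER: the transition operators `markovTransition V P t g` of two jointly measurable strong-solution families of the
step-`K` SZZ dynamics on any two probability spaces agree on measurable `g` (uniqueness in law from every deterministic start,
tree `Theorems.ColdStartUniversality.lawUnique_of_start` = SZZ Lemma 3.2 + Revuz–Yor IX (1.7), then `integral_map` twice).

Cell `ym-idea-1` extra width seat `ym-line-sfw-p2-w5` gen 9 (free hands; crux 22884 had no free stub).  HONEST FRAMING: the other
three stubs (in particular the load-bearing `stub_synchronousCoupling`) are NOT proved here; no crux, route item, rung or summit is
proved, and the Yang–Mills mass gap is NOT proved by any of this (R3 is a RECORD rung).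
-/

set_option autoImplicit false

noncomputable section

namespace Summit.QuantumFields.YangMills.Cruxes.WeightedAlmostInvariance.SynchronousShadow

open scoped BigOperators Topology Classical MeasureTheory ProbabilityTheory NNReal ENNReal
open Filter Set Function MeasureTheory
open Literature.MathematicalPhysics.QuantumFieldTheory
open Literature.MathematicalPhysics.QuantumFieldTheory.Balaban1983to89
open Literature.MathematicalPhysics.QuantumLattice

/-! ## The skeleton's vocabulary (verbatim from `SynchronousShadow.lean`, planner ym-idea-5 g11) -/

/-- The gauge group `SU(2)` as `2 × 2` complex matrices. -/
abbrev G2 : Type := Matrix.specialUnitaryGroup (Fin 2) ℂ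

/-- The SZZ lattice representation datum of `SU(2)` (verbatim from the crux). -/
noncomputable abbrev su2Rep : LatticeRep G2 :=
  ⟨2, fundamentalRep (Fin 2), continuous_fundamentalRep _, fundamentalRep_injective _, fundamentalRep_mem_unitaryGroup⟩

/-- Bałaban's small-loop average used by the leaf. -/
noncomputable abbrev avSU : LoopAverage G2 := ExpMeanLog.expMeanLogSU

/-- Step-`K` link configurations of the SZZ dynamics. -/
abbrev Cfg (F : T3ContinuumYM3Torus.T3Family) (K : ℕ) : Type := GaugeConfig 3 ((F.P K).sitesPerDir 0) G2

variable (F : T3ContinuumYM3Torus.T3Family)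

/-- A step-`K` link configuration read as a level-0 gauge field of Bałaban's `K`-th lattice. -/
def toField (K : ℕ) (c : Cfg F K) : GaugeField (F.P K) 0 G2 :=
  fun b : PBond (F.P K) 0 => c (b.src, b.dir)

/-- Jointly measurable strong-solution family of the step-`K` SZZ dynamics from every deterministic start (route shape). -/
def IsSolFamily (γ : ℝ) (K : ℕ) {Ω : Type} [MeasurableSpace Ω] (P : Measure Ω)
    (W : ℝ≥0 → Ω → (Edge 3 ((F.P K).sitesPerDir 0) × NoiseIdx 2 → ℝ)) (hW : IsFlatBrownian W P)
    (V : Cfg F K → ℝ≥0 → Ω → Cfg F K) : Prop :=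
  (∀ x, (∀ ω, V x 0 ω = x) ∧
    (latticeLangevinDynamics su2Rep ((γ * (F.P K).eps)⁻¹ / 2)).IsSolution (fundamentalRep (Fin 2))
      hW.natFiltration P W (V x)) ∧
  ∀ t : ℝ≥0, Measurable (fun p : Cfg F K × Ω => V p.1 t p.2)

/-- The `j`-fold block-averaged field of a step-`K` configuration. -/
noncomputable def avgField (K j : ℕ) (c : Cfg F K) : GaugeField (F.P K) j G2 :=
  Averaging.iter (fun i => BlockAveraging.blockAvg (P := F.P K) (j := i) avSU) j (toField F K c)

/-- Sup-entry distance of two depth-`j` gauge fields. -/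
noncomputable def fieldDistAt (K j : ℕ) (V V' : GaugeField (F.P K) j G2) : ℝ :=
  ⨆ p : PBond (F.P K) j × Fin 2 × Fin 2,
    ‖(V p.1 : Matrix (Fin 2) (Fin 2) ℂ) p.2.1 p.2.2 - (V' p.1 : Matrix (Fin 2) (Fin 2) ℂ) p.2.1 p.2.2‖

/-- Depth-`j` discrepancy modulo the depth-`j` gauge group. -/
noncomputable def discG (K j : ℕ) (u v : Cfg F K) : ℝ :=
  ⨅ h : GaugeTransf (F.P K) j G2, fieldDistAt F K j (avgField F K j u) (GaugeField.gaugeAct h (avgField F K j v))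

/-- Scale-weighted transport weight `wd_K = Σ_{j ≤ K} L^{-(K-j)} · discG_j` (the route's currency). -/
noncomputable def wdisc (K : ℕ) (u v : Cfg F K) : ℝ :=
  ∑ j ∈ Finset.range (K + 1), ((F.L : ℝ)⁻¹) ^ (K - j) * discG F K j u v

/-- One renormalisation step read on configurations `Cfg_{K+1} → Cfg_K`. -/
noncomputable def descendCfg (K : ℕ) (c : Cfg F (K + 1)) : Cfg F K :=
  fun e => T3NestedUnitLaws.descend F avSU K (toField F (K + 1) c) ⟨e.1, e.2⟩

/-- The weighted semimetric `√(wd_K(u,v)·(1 + Λ u + Λ v))`. -/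
noncomputable def dW (K : ℕ) (Λ : Cfg F K → ℝ) (u v : Cfg F K) : ℝ :=
  Real.sqrt (wdisc F K u v * (1 + Λ u + Λ v))

/-- The Λ-weighted Lipschitz class `𝒢_K^Λ(A)`. -/
def InClsW (K : ℕ) (Λ : Cfg F K → ℝ) (A : ℝ) (g : Cfg F K → ℝ) : Prop :=
  Measurable g ∧ (∀ u, |g u| ≤ 1) ∧ ∀ u v, |g u - g v| ≤ A * dW F K Λ u v

/-- The step-`K+1` Gibbs law of the route (Bałaban's `gibbsMeasure` at `β_{K+1} = (γ ε_{K+1})⁻¹`). -/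
noncomputable abbrev gibbsSucc (γ : ℝ) (K : ℕ) : Measure (GaugeField (F.P (K + 1)) 0 G2) :=
  T4GenFunBounds.gibbsMeasure (F.P (K + 1))
    ((F.scheme (ExpMeanLog.expMeanLogSU : LoopAverage (Matrix.specialUnitaryGroup (Fin 2) ℂ)) γ).β (K + 1))

/-- The TOP-REGULARITY THRESHOLD `θ_K = (γ ε_{K+1})^a`. -/
noncomputable abbrev thr (γ a : ℝ) (K : ℕ) : ℝ := (γ * (F.P (K + 1)).eps) ^ a

/-- MASS CLAUSE at one `K`: the Gibbs_{K+1}-mass of the top-irregular fine starts is at most `e`. -/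
def MassClause (γ θ : ℝ) (K : ℕ) (e : ℝ) : Prop :=
  (gibbsSucc F γ K).real {U | ¬ PlaqSmall θ U} ≤ e

/-- POINTWISE SHADOW CLAUSE at one `K` for a coarse family `V` (window `t`) and a fine family `V'` (window `t'`), in the route's
DUAL (weighted-Lipschitz) currency: from every top-regular fine start `U`, the fine transition of `g ∘ descend` and the coarse
transition of `g` at `descend U` differ by at most `A·ρ·√(1 + P'_{t'}(Λ∘descend)(U) + P_t Λ(descend U))` for every bounded
measurable weight `Λ ≥ 0` and every `g ∈ 𝒢_K^Λ(A)` — the Kantorovich-dual form of «a coupling with `E wd_K ≤ ρ²`» after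
Cauchy–Schwarz (no transport integral is typed, so no measurability junk can satisfy it vacuously). -/
def PointwiseClause (θ : ℝ) (K : ℕ) {Ω : Type} [MeasurableSpace Ω] (P : Measure Ω) (V : Cfg F K → ℝ≥0 → Ω → Cfg F K)
    (t : ℝ≥0) {Ω' : Type} [MeasurableSpace Ω'] (P' : Measure Ω') (V' : Cfg F (K + 1) → ℝ≥0 → Ω' → Cfg F (K + 1))
    (t' : ℝ≥0) (ρ : ℝ) : Prop :=
  ∀ U : GaugeField (F.P (K + 1)) 0 G2, PlaqSmall θ U →
    ∀ (Λ : Cfg F K → ℝ), Measurable Λ → (∀ u, 0 ≤ Λ u) → (∃ M : ℝ, ∀ u, Λ u ≤ M) →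
    ∀ (A : ℝ) (g : Cfg F K → ℝ), InClsW F K Λ A g →
      |markovTransition V' P' t' (g ∘ descendCfg F K) (fun e => U ⟨e.1, e.2⟩) -
          markovTransition V P t g (fun e => T3NestedUnitLaws.descend F
            (ExpMeanLog.expMeanLogSU : LoopAverage (Matrix.specialUnitaryGroup (Fin 2) ℂ)) K U ⟨e.1, e.2⟩)|
        ≤ A * (ρ * Real.sqrt (1 + markovTransition V' P' t' (Λ ∘ descendCfg F K) (fun e => U ⟨e.1, e.2⟩) +
            markovTransition V P t Λ (fun e => T3NestedUnitLaws.descend F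
              (ExpMeanLog.expMeanLogSU : LoopAverage (Matrix.specialUnitaryGroup (Fin 2) ℂ)) K U ⟨e.1, e.2⟩)))

/-- IDENTITY CLAUSE at one `K` for a fine family: `∫ g∘descend dGibbs_{K+1} = ∫ P'_{t'}(g∘descend) dGibbs_{K+1}`. -/
def IdentityClause (γ : ℝ) (K : ℕ) {Ω' : Type} [MeasurableSpace Ω'] (P' : Measure Ω')
    (V' : Cfg F (K + 1) → ℝ≥0 → Ω' → Cfg F (K + 1)) (t' : ℝ≥0) : Prop :=
  ∀ g : Cfg F K → ℝ, Measurable g → (∀ u, |g u| ≤ 1) →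
    (∫ U, g (fun e => T3NestedUnitLaws.descend F
          (ExpMeanLog.expMeanLogSU : LoopAverage (Matrix.specialUnitaryGroup (Fin 2) ℂ)) K U ⟨e.1, e.2⟩) ∂(gibbsSucc F γ K)) =
    ∫ U, markovTransition V' P' t' (g ∘ descendCfg F K) (fun e => U ⟨e.1, e.2⟩) ∂(gibbsSucc F γ K)


/-! ## The four stub statements of r3 (verbatim) -/

/-- STUB 1 (M, shared verbatim with r1/r2). FINE-WINDOW IDENTITY: Gibbs_{K+1}-invariance of the step-(K+1) dynamics tested on `g ∘ descend`. -/
def FineWindowIdentity : Prop :=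
  ∀ (F : T3ContinuumYM3Torus.T3Family) (γ : ℝ), 0 < γ → ∀ (τ : ℝ), 0 < τ → ∀ (K : ℕ)
    (Ω' : Type) (mΩ' : MeasurableSpace Ω') (P' : Measure Ω') (_hP' : IsProbabilityMeasure P')
    (W' : ℝ≥0 → Ω' → (Edge 3 ((F.P (K + 1)).sitesPerDir 0) × NoiseIdx 2 → ℝ)) (hW' : IsFlatBrownian W' P')
    (V' : Cfg F (K + 1) → ℝ≥0 → Ω' → Cfg F (K + 1)), IsSolFamily F γ (K + 1) P' W' hW' V' →
    ∀ g : Cfg F K → ℝ, Measurable g → (∀ u, |g u| ≤ 1) →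
      (∫ U, g (fun e => T3NestedUnitLaws.descend F
            (ExpMeanLog.expMeanLogSU : LoopAverage (Matrix.specialUnitaryGroup (Fin 2) ℂ)) K U ⟨e.1, e.2⟩)
          ∂(T4GenFunBounds.gibbsMeasure (F.P (K + 1))
            ((F.scheme (ExpMeanLog.expMeanLogSU : LoopAverage (Matrix.specialUnitaryGroup (Fin 2) ℂ)) γ).β (K + 1)))) =
      ∫ U, markovTransition V' P' (τ / (F.P (K + 1)).eps).toNNReal (g ∘ descendCfg F K) (fun e => U ⟨e.1, e.2⟩)
          ∂(T4GenFunBounds.gibbsMeasure (F.P (K + 1))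
            ((F.scheme (ExpMeanLog.expMeanLogSU : LoopAverage (Matrix.specialUnitaryGroup (Fin 2) ℂ)) γ).β (K + 1)))


/-- STUB L (S, NEW, landable now). LAW TRANSFER: the transition operators of the step-`K` SZZ dynamics do not depend on the
realisation — two jointly measurable strong-solution families on any two probability spaces, same start ⇒ same law at every
time (tree `ColdStartUniversality.lawUnique_of_start`, then `integral_map`). -/
def LawTransfer : Prop :=
  ∀ (F : T3ContinuumYM3Torus.T3Family) (γ : ℝ) (K : ℕ)
    (Ω : Type) (mΩ : MeasurableSpace Ω) (P : Measure Ω) (_hP : IsProbabilityMeasure P)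
    (W : ℝ≥0 → Ω → (Edge 3 ((F.P K).sitesPerDir 0) × NoiseIdx 2 → ℝ)) (hW : IsFlatBrownian W P)
    (V : Cfg F K → ℝ≥0 → Ω → Cfg F K), IsSolFamily F γ K P W hW V →
    ∀ (Ω₂ : Type) (mΩ₂ : MeasurableSpace Ω₂) (P₂ : Measure Ω₂) (_hP₂ : IsProbabilityMeasure P₂)
    (W₂ : ℝ≥0 → Ω₂ → (Edge 3 ((F.P K).sitesPerDir 0) × NoiseIdx 2 → ℝ)) (hW₂ : IsFlatBrownian W₂ P₂)
    (V₂ : Cfg F K → ℝ≥0 → Ω₂ → Cfg F K), IsSolFamily F γ K P₂ W₂ hW₂ V₂ →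
    ∀ (t : ℝ≥0) (g : Cfg F K → ℝ), Measurable g → ∀ x : Cfg F K,
      markovTransition V P t g x = markovTransition V₂ P₂ t g x

/-- STUB C (XL, NEW, load-bearing). SYNCHRONOUS COUPLING WITH A SUMMABLE MEAN DISCREPANCY from every top-regular start — the
PRIMAL form of item 27784: one probability space carrying a fine and a coarse solution family whose windows from `U` and from
`descend U` are `ρ_K²`-close in mean `wd_K`, `Σ ρ_K < ∞` (the coupling may depend on `K` and on the start; the integrand is
asserted measurable, so the Bochner integral carries no junk value). -/
def SynchronousCoupling : Prop :=
  ∃ (a : ℝ), 0 < a ∧ a < 1 / 2 ∧ ∃ γ₁ : ℝ, 0 < γ₁ ∧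
    ∀ (F : T3ContinuumYM3Torus.T3Family) (γ : ℝ), 0 < γ → γ ≤ γ₁ → ∀ (τ : ℝ), 0 < τ →
    ∃ ρ : ℕ → ℝ, (∀ K, 0 ≤ ρ K) ∧ Summable ρ ∧
      ∀ (K : ℕ) (U : GaugeField (F.P (K + 1)) 0 G2), PlaqSmall (thr F γ a K) U →
      ∃ (Ω : Type) (_mΩ : MeasurableSpace Ω) (P : Measure Ω) (_hP : IsProbabilityMeasure P)
        (W' : ℝ≥0 → Ω → (Edge 3 ((F.P (K + 1)).sitesPerDir 0) × NoiseIdx 2 → ℝ)) (hW' : IsFlatBrownian W' P)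
        (V' : Cfg F (K + 1) → ℝ≥0 → Ω → Cfg F (K + 1))
        (W : ℝ≥0 → Ω → (Edge 3 ((F.P K).sitesPerDir 0) × NoiseIdx 2 → ℝ)) (hW : IsFlatBrownian W P)
        (V : Cfg F K → ℝ≥0 → Ω → Cfg F K),
        IsSolFamily F γ (K + 1) P W' hW' V' ∧ IsSolFamily F γ K P W hW V ∧
        Measurable (fun ω => wdisc F K
          (descendCfg F K (V' (fun e => U ⟨e.1, e.2⟩) (τ / (F.P (K + 1)).eps).toNNReal ω))
          (V (fun e => T3NestedUnitLaws.descend F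
            (ExpMeanLog.expMeanLogSU : LoopAverage (Matrix.specialUnitaryGroup (Fin 2) ℂ)) K U ⟨e.1, e.2⟩)
            (τ / (F.P K).eps).toNNReal ω)) ∧
        (∫ ω, wdisc F K
          (descendCfg F K (V' (fun e => U ⟨e.1, e.2⟩) (τ / (F.P (K + 1)).eps).toNNReal ω))
          (V (fun e => T3NestedUnitLaws.descend F
            (ExpMeanLog.expMeanLogSU : LoopAverage (Matrix.specialUnitaryGroup (Fin 2) ℂ)) K U ⟨e.1, e.2⟩)
            (τ / (F.P K).eps).toNNReal ω) ∂P) ≤ ρ K ^ 2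

/-- STUB W (S/M, NEW, pure measure theory, landable now). FROM A COUPLING TO THE WEIGHTED DUAL BOUND: `E wd_K(X,Y) ≤ r²` ⇒
`|E g(X) − E g(Y)| ≤ A·r·√(1 + EΛ(X) + EΛ(Y))` for every bounded measurable weight `Λ ≥ 0` and `g ∈ 𝒢_K^Λ(A)` (Cauchy–Schwarz;
`A < 0` is the vacuous corner since `wd_K` separates some pair of configurations, cf. the landed `shadowAveraging_proof`). -/
def CouplingToWeighted : Prop :=
  ∀ (F : T3ContinuumYM3Torus.T3Family) (K : ℕ) (Ω : Type) (_mΩ : MeasurableSpace Ω) (P : Measure Ω),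
    IsProbabilityMeasure P →
    ∀ (X Y : Ω → Cfg F K), Measurable X → Measurable Y → Measurable (fun ω => wdisc F K (X ω) (Y ω)) →
    ∀ (r : ℝ), 0 ≤ r → (∫ ω, wdisc F K (X ω) (Y ω) ∂P) ≤ r ^ 2 →
    ∀ (Λ : Cfg F K → ℝ), Measurable Λ → (∀ u, 0 ≤ Λ u) → (∃ M : ℝ, ∀ u, Λ u ≤ M) →
    ∀ (A : ℝ) (g : Cfg F K → ℝ), InClsW F K Λ A g →
      |(∫ ω, g (X ω) ∂P) - ∫ ω, g (Y ω) ∂P| ≤ A * (r * Real.sqrt (1 + (∫ ω, Λ (X ω) ∂P) + ∫ ω, Λ (Y ω) ∂P))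

namespace __Registered
/-- registered stub alias (shared verbatim with r1/r2; M) -/ abbrev stub_fineWindowIdentity : Prop := FineWindowIdentity
/-- registered stub alias (NEW; S) -/ abbrev stub_lawTransfer : Prop := LawTransfer
/-- registered stub alias (NEW; XL, load-bearing) -/ abbrev stub_synchronousCoupling : Prop := SynchronousCoupling
/-- registered stub alias (NEW; S/M) -/ abbrev stub_couplingToWeighted : Prop := CouplingToWeighted
end __Registered


/-! ## The registered stub L, by name and signature -/

/-- The one-time law of a member of a jointly measurable strong-solution family of the step-`K` SZZ dynamics does not depend on
the realisation: two `IsSolFamily` data on any two probability spaces give the same law of `V x t` for every start `x` and every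
lattice time `t` (uniqueness in law from a deterministic start, `ColdStartUniversality.lawUnique_of_start`).
[cite: RevuzYor1999, Ch. IX Thm (1.7)] [cite: ShenZhuZhu2022, §3 Lemma 3.2 (p. 13)] -/
theorem map_eq_map_of_isSolFamily (γ : ℝ) (K : ℕ)
    {Ω : Type} {mΩ : MeasurableSpace Ω} {P : Measure Ω} [IsProbabilityMeasure P]
    {W : ℝ≥0 → Ω → (Edge 3 ((F.P K).sitesPerDir 0) × NoiseIdx 2 → ℝ)} {hW : IsFlatBrownian W P}
    {V : Cfg F K → ℝ≥0 → Ω → Cfg F K} (hV : IsSolFamily F γ K P W hW V)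
    {Ω₂ : Type} {mΩ₂ : MeasurableSpace Ω₂} {P₂ : Measure Ω₂} [IsProbabilityMeasure P₂]
    {W₂ : ℝ≥0 → Ω₂ → (Edge 3 ((F.P K).sitesPerDir 0) × NoiseIdx 2 → ℝ)} {hW₂ : IsFlatBrownian W₂ P₂}
    {V₂ : Cfg F K → ℝ≥0 → Ω₂ → Cfg F K} (hV₂ : IsSolFamily F γ K P₂ W₂ hW₂ V₂) (x : Cfg F K) (t : ℝ≥0) :
    Measure.map (V x t) P = Measure.map (V₂ x t) P₂ :=
  haveI : NeZero ((F.P K).sitesPerDir 0) := ⟨(F.P K).sitesPerDir_ne_zero 0⟩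
  Summit.QuantumFields.YangMills.Theorems.ColdStartUniversality.lawUnique_of_start ((γ * (F.P K).eps)⁻¹ / 2) x hW hW₂
    (hV.1 x).1 (hV.1 x).2 (hV₂.1 x).1 (hV₂.1 x).2 t

/-- Each time-`t` section `ω ↦ V x t ω` of a jointly measurable solution family is measurable. [folklore] -/
theorem measurable_section_of_isSolFamily (γ : ℝ) (K : ℕ)
    {Ω : Type} {mΩ : MeasurableSpace Ω} {P : Measure Ω}
    {W : ℝ≥0 → Ω → (Edge 3 ((F.P K).sitesPerDir 0) × NoiseIdx 2 → ℝ)} {hW : IsFlatBrownian W P}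
    {V : Cfg F K → ℝ≥0 → Ω → Cfg F K} (hV : IsSolFamily F γ K P W hW V) (x : Cfg F K) (t : ℝ≥0) :
    Measurable (V x t) :=
  (hV.2 t).comp measurable_prodMk_left

/-- **STUB L `stub_lawTransfer` HOLDS.**  LAW TRANSFER: for two jointly measurable strong-solution families of the step-`K` SZZ
dynamics on any two probability spaces, `markovTransition V P t g x = markovTransition V₂ P₂ t g x` for every `t`, every
measurable `g` and every start `x` — the transition operators `P_t g(x) = 𝔼 g(V^x_t)` are realisation-independent
(`lawUnique_of_start`, then `integral_map` on both sides; no integrability is needed since both Bochner integrals are computed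
against the same image law). [cite: ShenZhuZhu2022, §3 Lemma 3.2 (p. 13)] [cite: RevuzYor1999, Ch. IX Thm (1.7)] -/
theorem stub_lawTransfer : __Registered.stub_lawTransfer := by
  intro F γ K Ω mΩ P hP W hW V hV Ω₂ mΩ₂ P₂ hP₂ W₂ hW₂ V₂ hV₂ t g hg x
  have hmap : Measure.map (V x t) P = Measure.map (V₂ x t) P₂ := map_eq_map_of_isSolFamily F γ K hV hV₂ x t
  have hm : Measurable (V x t) := measurable_section_of_isSolFamily F γ K hV x t
  have hm₂ : Measurable (V₂ x t) := measurable_section_of_isSolFamily F γ K hV₂ x t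
  show ∫ ω, g (V x t ω) ∂P = ∫ ω, g (V₂ x t ω) ∂P₂
  calc ∫ ω, g (V x t ω) ∂P = ∫ y, g y ∂(Measure.map (V x t) P) :=
        (integral_map hm.aemeasurable hg.aestronglyMeasurable).symm
    _ = ∫ y, g y ∂(Measure.map (V₂ x t) P₂) := by rw [hmap]
    _ = ∫ ω, g (V₂ x t ω) ∂P₂ := integral_map hm₂.aemeasurable hg.aestronglyMeasurable

end Summit.QuantumFields.YangMills.Cruxes.WeightedAlmostInvariance.SynchronousShadow

end
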